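import Summits.Ventures.Crystal3D.Theorems.StickyWulffConstantGenericWallFloorTailSeparation
import Summits.Ventures.Crystal3D.Theorems.StickyWulffConstantGenericWallFloorCapStartBarlow
import Summits.Ventures.Crystal3D.Theorems.StickyWulffConstantTextureLiminfTexShadowPresentationFlip
import HarnessLib

/-!
# Tail separation, ONE-SIDED form: an unread grain-1 family is apart from the passive lattice AND its basal twin
# (crux `GenericWallFloor`, stmt-Ventures-19480, line `WallLedgerG`; lane T row (e) `stub_residualFaulted`, K0 of HOME/wall-p2-g10/FAULTED-LEDGER-MEMO.md)

HONEST FRAMING. Venture `Summits/Ventures/Crystal3D` (cell `crystal3d-full`), helper `--supports` the crux `GenericWallFloor`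
(stmt-Ventures-19480) of `route-Ventures-StickyWulffConstant`, registered line `WallLedgerG`.  Rung credit only (census-free, standard
axioms); F-C1 not moved; NOT the stub.

`chainFrames_separated_of_unread` (…TailSeparation) is TWO-SIDED: both grains' families unread ⇒ no chain frame of grain 1 is
Barlow-co-axial with a chain frame of grain 2.  The one-sided Barlow ledger of row (e) (`barlowFamily_card_le_payers_oneSided`, clause (i)
of `FramesApart`) needs only the ONE-SIDED form, with NO hypothesis on grain 2's rays: if grain 1's ray words of depth `d + 1` are not
read by the relative word `κ` (`|κ| ≥ d + 2`), then no chain frame of grain 1 is Barlow-co-axial with the BASE frame `A₂` — in particular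
no chain frame carries `A₂·Λ₀` NOR ITS BASAL TWIN `(twinFrame A₂ (A₂ e₃))·Λ₀` (both are Barlow stackings in `A₂`'s layer frame).  So in
the tail regime the «second lattice of the passive plate» costs nothing (memo K0).  Proof: the read witness `exists_read_witness_word`
with grain 2's ray EMPTY (`β = []`, tip `A₂` itself) forces grain 1 to read `≥ |κ| − 1 ≥ d + 1` letters, against `hread₁`.
* `chainFrames_not_coaxial_base_of_unread` — `∀ F₁ ∈ chainFrames z₁ A₁ u₁, ¬ CoAx(F₁, A₂)`;
* **`chainFrames_apart_of_unread`** — clause (i) of `FramesApart` for the family: `F₁''Λ₀ ≠ A₂''Λ₀ ∧ F₁''Λ₀ ≠ (twinFrame A₂ (A₂e₃))''Λ₀`;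
* `stackFrames_apart_of_unread` — the same for every frame of every sound well-formed `z₁`-stack over `(A₁, u₁, 0)`.
WHAT THIS IS NOT: no certificate row is discharged here; not the stub; F-C1 not moved.
-/

noncomputable section

namespace Summit.Ventures.Crystal3D.Theorems

open Summit.Ventures.Crystal3D
open Literature.MathematicalPhysics.StatisticalMechanics (fccStacking barlowStacking IsHaggSeq constHagg isHaggSeq_const basalMirror)
open Summit.Ventures.Crystal3D.Cruxes.TextureLiminf.TexShadow (basalMirror_mem_barlowStacking_iff)
open scoped InnerProductSpace

/-- **One-sided tail separation.**  `κ` a model mirror word presenting `A₂` over `A₁` (`|κ| ≥ d + 2`), grain 1's ray words of depth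
`d + 1` not read by the end of `κ` ⇒ no chain frame of grain 1 is Barlow-co-axial with `A₂`. -/
theorem chainFrames_not_coaxial_base_of_unread {z₁ : EuclideanSpace ℝ (Fin 3)}
    {A₁ A₂ : EuclideanSpace ℝ (Fin 3) ≃ₗᵢ[ℝ] EuclideanSpace ℝ (Fin 3)} {u₁ : EuclideanSpace ℝ (Fin 3)}
    {κ : List (EuclideanSpace ℝ (Fin 3))}
    (hκl : ∀ μ ∈ κ, ‖μ‖ = 1 ∧
      ∀ w ∈ fccSlots, ⟪w, μ⟫_ℝ = 0 ∨ ⟪w, μ⟫_ℝ = Real.sqrt (2 / 3) ∨ ⟪w, μ⟫_ℝ = -Real.sqrt (2 / 3))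
    (hκc : List.IsChain (fun μ μ' => ⟪μ, μ'⟫_ℝ = 1 / 3 ∨ ⟪μ, μ'⟫_ℝ = -1 / 3) κ)
    (hA₂ : A₂ '' fccStacking 1 (Real.sqrt (2 / 3)) = (wordFrame A₁ κ) '' fccStacking 1 (Real.sqrt (2 / 3)))
    {d : ℕ} (hd : d + 2 ≤ κ.length)
    (hread₁ : ∀ n₁ : EuclideanSpace ℝ (Fin 3), ‖n₁‖ = 1 →
      (∀ w ∈ fccSlots, ⟪A₁ w, n₁⟫_ℝ = 0 ∨ ⟪A₁ w, n₁⟫_ℝ = Real.sqrt (2 / 3) ∨ ⟪A₁ w, n₁⟫_ℝ = -Real.sqrt (2 / 3)) →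
      ⟪A₁ u₁, n₁⟫_ℝ = Real.sqrt (2 / 3) →
      (rayWord z₁ ⟨A₁, u₁, 0⟩ n₁ (d + 1)).map (fun μ => (ℝ ∙ μ)ᗮ.reflection) ≠
        (κ.drop (κ.length - (d + 1))).map (fun μ => (ℝ ∙ μ)ᗮ.reflection)) :
    ∀ F₁ ∈ chainFrames z₁ A₁ u₁,
      ¬ ∃ (L : EuclideanSpace ℝ (Fin 3) ≃ₗᵢ[ℝ] EuclideanSpace ℝ (Fin 3))
        (s₁ s₂ : EuclideanSpace ℝ (Fin 3)) (σ σ' : ℤ → ℤ), IsHaggSeq σ ∧ IsHaggSeq σ' ∧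
        F₁ '' fccStacking 1 (Real.sqrt (2 / 3)) ⊆ (fun p => L p + s₁) '' barlowStacking 1 (Real.sqrt (2 / 3)) σ ∧
        A₂ '' fccStacking 1 (Real.sqrt (2 / 3)) ⊆ (fun p => L p + s₂) '' barlowStacking 1 (Real.sqrt (2 / 3)) σ' := by
  intro F₁ hF₁ hco
  obtain ⟨α, hF₁α, hαl, hαc, hray₁⟩ := exists_rayData hF₁
  -- grain 2's ray is EMPTY: its tip is the base frame `A₂` itself
  have hβl : ∀ μ ∈ ([] : List (EuclideanSpace ℝ (Fin 3))), ‖μ‖ = 1 ∧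
      ∀ w ∈ fccSlots, ⟪w, μ⟫_ℝ = 0 ∨ ⟪w, μ⟫_ℝ = Real.sqrt (2 / 3) ∨ ⟪w, μ⟫_ℝ = -Real.sqrt (2 / 3) :=
    fun μ hμ => absurd hμ List.not_mem_nil
  have hβc : List.IsChain (fun μ μ' : EuclideanSpace ℝ (Fin 3) => ⟪μ, μ'⟫_ℝ = 1 / 3 ∨ ⟪μ, μ'⟫_ℝ = -1 / 3) [] :=
    List.isChain_nil
  have hray₂ : ∀ d' : ℕ, d' ≤ ([] : List (EuclideanSpace ℝ (Fin 3))).length →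
      ∃ G ∈ chainFrames z₁ A₂ u₁, G = wordFrame A₂ (([] : List (EuclideanSpace ℝ (Fin 3))).drop
        (([] : List (EuclideanSpace ℝ (Fin 3))).length - d')) ∧
      (d' = 0 ∧ G = A₂ ∨ ∃ n : EuclideanSpace ℝ (Fin 3), ‖n‖ = 1 ∧
        (∀ w ∈ fccSlots, ⟪A₂ w, n⟫_ℝ = 0 ∨ ⟪A₂ w, n⟫_ℝ = Real.sqrt (2 / 3) ∨ ⟪A₂ w, n⟫_ℝ = -Real.sqrt (2 / 3)) ∧
        ⟪A₂ u₁, n⟫_ℝ = Real.sqrt (2 / 3) ∧ 0 < d' ∧ G = (forcedTop z₁ ⟨A₂, u₁, 0⟩ n (d' - 1)).frame) := by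
    intro d' hd'
    have hd'0 : d' = 0 := Nat.le_zero.1 (by simpa using hd')
    exact ⟨A₂, self_mem_chainFrames z₁ A₂ u₁, by simp only [List.drop_nil]; rfl, Or.inl ⟨hd'0, rfl⟩⟩
  obtain ⟨d₁, d₂, hd₁α, hd₂β, hsum0, hsum, hrd, G₁, -, G₂, -, hG₁w, -, hG₁d, -, -⟩ :=
    exists_read_witness_word hκl hκc hA₂ hF₁α hαl hαc hray₁ (rfl : A₂ = wordFrame A₂ []) hβl hβc hray₂ hco
  have hd₂0 : d₂ = 0 := Nat.le_zero.1 (by simpa using hd₂β)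
  set α' := α.drop (α.length - d₁) with hα'
  have hα'l : ∀ μ ∈ α', ‖μ‖ = 1 ∧
      ∀ w ∈ fccSlots, ⟪w, μ⟫_ℝ = 0 ∨ ⟪w, μ⟫_ℝ = Real.sqrt (2 / 3) ∨ ⟪w, μ⟫_ℝ = -Real.sqrt (2 / 3) :=
    fun μ hμ => hαl μ (List.mem_of_mem_drop hμ)
  have hα'c : List.IsChain (fun μ μ' => ⟪μ, μ'⟫_ℝ = 1 / 3 ∨ ⟪μ, μ'⟫_ℝ = -1 / 3) α' := by
    have := hαc; rw [← List.take_append_drop (α.length - d₁) α] at this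
    exact (List.isChain_append.1 this).2.1
  -- grain 1 reads `d₁ ≥ |κ| − 1 ≥ d + 1` letters: contradiction with `hread₁`
  rcases hG₁d with ⟨h0, -⟩ | ⟨n₁, hn₁, hmenu₁, hpos₁, hd₁pos, hG₁node⟩
  · omega
  · have hread := rayWord_map_eq_of_node hn₁ hmenu₁ hα'l hα'c hG₁w hd₁pos hG₁node
    have hj := rayWord_map_eq_drop z₁ ⟨A₁, u₁, 0⟩ n₁ (by omega : d + 1 ≤ d₁) hread
    refine hread₁ n₁ hn₁ hmenu₁ hpos₁ ?_
    rw [hj, ← map_reflection_drop_congr hrd (d₁ - (d + 1)), List.drop_drop]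
    congr 2
    omega

/-- **Clause (i) of `FramesApart` from unread ray words.**  Under the hypotheses of `chainFrames_not_coaxial_base_of_unread`, no chain
frame of grain 1 carries the passive lattice `A₂·Λ₀` NOR its basal twin's lattice `(twinFrame A₂ (A₂ e₃))·Λ₀`. -/
theorem chainFrames_apart_of_unread {z₁ : EuclideanSpace ℝ (Fin 3)}
    {A₁ A₂ : EuclideanSpace ℝ (Fin 3) ≃ₗᵢ[ℝ] EuclideanSpace ℝ (Fin 3)} {u₁ : EuclideanSpace ℝ (Fin 3)}
    {κ : List (EuclideanSpace ℝ (Fin 3))}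
    (hκl : ∀ μ ∈ κ, ‖μ‖ = 1 ∧
      ∀ w ∈ fccSlots, ⟪w, μ⟫_ℝ = 0 ∨ ⟪w, μ⟫_ℝ = Real.sqrt (2 / 3) ∨ ⟪w, μ⟫_ℝ = -Real.sqrt (2 / 3))
    (hκc : List.IsChain (fun μ μ' => ⟪μ, μ'⟫_ℝ = 1 / 3 ∨ ⟪μ, μ'⟫_ℝ = -1 / 3) κ)
    (hA₂ : A₂ '' fccStacking 1 (Real.sqrt (2 / 3)) = (wordFrame A₁ κ) '' fccStacking 1 (Real.sqrt (2 / 3)))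
    {d : ℕ} (hd : d + 2 ≤ κ.length)
    (hread₁ : ∀ n₁ : EuclideanSpace ℝ (Fin 3), ‖n₁‖ = 1 →
      (∀ w ∈ fccSlots, ⟪A₁ w, n₁⟫_ℝ = 0 ∨ ⟪A₁ w, n₁⟫_ℝ = Real.sqrt (2 / 3) ∨ ⟪A₁ w, n₁⟫_ℝ = -Real.sqrt (2 / 3)) →
      ⟪A₁ u₁, n₁⟫_ℝ = Real.sqrt (2 / 3) →
      (rayWord z₁ ⟨A₁, u₁, 0⟩ n₁ (d + 1)).map (fun μ => (ℝ ∙ μ)ᗮ.reflection) ≠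
        (κ.drop (κ.length - (d + 1))).map (fun μ => (ℝ ∙ μ)ᗮ.reflection)) :
    ∀ F₁ ∈ chainFrames z₁ A₁ u₁,
      F₁ '' fccStacking 1 (Real.sqrt (2 / 3)) ≠ A₂ '' fccStacking 1 (Real.sqrt (2 / 3)) ∧
      F₁ '' fccStacking 1 (Real.sqrt (2 / 3)) ≠
        (twinFrame A₂ (A₂ (EuclideanSpace.single (2 : Fin 3) (1 : ℝ)))) '' fccStacking 1 (Real.sqrt (2 / 3)) := by
  intro F₁ hF₁
  have h := chainFrames_not_coaxial_base_of_unread hκl hκc hA₂ hd hread₁ F₁ hF₁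
  have hinc : A₂ '' fccStacking 1 (Real.sqrt (2 / 3)) ⊆
      (fun p => A₂ p + 0) '' barlowStacking 1 (Real.sqrt (2 / 3)) constHagg := by
    rintro _ ⟨p, hp, rfl⟩; exact ⟨p, hp, by simp⟩
  refine ⟨fun heq => h ⟨A₂, 0, 0, constHagg, constHagg, isHaggSeq_const, isHaggSeq_const, by rw [heq]; exact hinc, hinc⟩,
    fun heq => h ⟨A₂, 0, 0, (fun n => -constHagg (-n - 1)), constHagg, fun n => Or.inr (by simp [constHagg]), isHaggSeq_const,
      ?_, hinc⟩⟩
  rw [heq]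
  rintro _ ⟨p, hp, rfl⟩
  refine ⟨basalMirror p, (basalMirror_mem_barlowStacking_iff constHagg p).2 hp, ?_⟩
  simp only [add_zero, twinFrame_axis_apply]

/-- **The stack form**: every frame of every sound well-formed `z₁`-stack over `(A₁, u₁, 0)` is apart from `A₂·Λ₀` and its basal twin. -/
theorem stackFrames_apart_of_unread {z₁ : EuclideanSpace ℝ (Fin 3)}
    {A₁ A₂ : EuclideanSpace ℝ (Fin 3) ≃ₗᵢ[ℝ] EuclideanSpace ℝ (Fin 3)} {u₁ : EuclideanSpace ℝ (Fin 3)}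
    {κ : List (EuclideanSpace ℝ (Fin 3))}
    (hκl : ∀ μ ∈ κ, ‖μ‖ = 1 ∧
      ∀ w ∈ fccSlots, ⟪w, μ⟫_ℝ = 0 ∨ ⟪w, μ⟫_ℝ = Real.sqrt (2 / 3) ∨ ⟪w, μ⟫_ℝ = -Real.sqrt (2 / 3))
    (hκc : List.IsChain (fun μ μ' => ⟪μ, μ'⟫_ℝ = 1 / 3 ∨ ⟪μ, μ'⟫_ℝ = -1 / 3) κ)
    (hA₂ : A₂ '' fccStacking 1 (Real.sqrt (2 / 3)) = (wordFrame A₁ κ) '' fccStacking 1 (Real.sqrt (2 / 3)))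
    {d : ℕ} (hd : d + 2 ≤ κ.length)
    (hread₁ : ∀ n₁ : EuclideanSpace ℝ (Fin 3), ‖n₁‖ = 1 →
      (∀ w ∈ fccSlots, ⟪A₁ w, n₁⟫_ℝ = 0 ∨ ⟪A₁ w, n₁⟫_ℝ = Real.sqrt (2 / 3) ∨ ⟪A₁ w, n₁⟫_ℝ = -Real.sqrt (2 / 3)) →
      ⟪A₁ u₁, n₁⟫_ℝ = Real.sqrt (2 / 3) →
      (rayWord z₁ ⟨A₁, u₁, 0⟩ n₁ (d + 1)).map (fun μ => (ℝ ∙ μ)ᗮ.reflection) ≠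
        (κ.drop (κ.length - (d + 1))).map (fun μ => (ℝ ∙ μ)ᗮ.reflection)) :
    ∀ stk₁ : List WalkEntry, StackSound z₁ stk₁ → StackWF z₁ stk₁ → stk₁.getLast? = some ⟨A₁, u₁, 0⟩ →
    ∀ e₁ ∈ stk₁,
      e₁.frame '' fccStacking 1 (Real.sqrt (2 / 3)) ≠ A₂ '' fccStacking 1 (Real.sqrt (2 / 3)) ∧
      e₁.frame '' fccStacking 1 (Real.sqrt (2 / 3)) ≠
        (twinFrame A₂ (A₂ (EuclideanSpace.single (2 : Fin 3) (1 : ℝ)))) '' fccStacking 1 (Real.sqrt (2 / 3)) :=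
  fun _ hS₁ hW₁ hl₁ e₁ he₁ =>
    chainFrames_apart_of_unread hκl hκc hA₂ hd hread₁ e₁.frame (frame_mem_chainFrames_of_stack hS₁ hW₁ hl₁ e₁ he₁)

end Summit.Ventures.Crystal3D.Theorems

end
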